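import Summits.Parity.BatemanHorn.Theorems.SoloInformedCubicPrimeCount

/-!
# SoloInformedPrimePowerCensus — the proper-prime-power term of `ψ_g`, sorted by exponent

Solo unit `solo-Parity-informed` (ideation tier, informed mode), session 15; `PLAN.md` §23, CLAIMS C66.

For `g ∈ ℤ[X]` of degree `d ≥ 1` with `g(n) > 0` for `n ≥ n₀` and `|log |g(n)| - d log n| ≤ B`:

  `PP_g(x) = ∑_{1 ≤ n ≤ x, |g(n)| not prime} Λ(|g(n)|)`
    `≤ (d log x + B) · (n₀ + ∑_{2 ≤ k ≤ d} #{n ≤ x : g(n) = p^k, p prime} + #{n ≤ x : |g(n)| = m^k, k > d})`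

(`properPrimePow_polyVal_sum_le_natDegree`), and the last count is harmless: a value `|g(n)| = m^k ≤ e^B x^d`
with `k ≥ d + 1` has `m ≤ (e^B x^d)^{1/(d+1)}`, `k ≤ log(e^B x^d)/log 2`, and each value is taken `≤ 2d` times,
so `(d + 1) log x · #{…} ≪ x^{d/(d+1)} (log x)² = o(x)` (`eventually_higherPow_count_mul_log_le_natDegree`).
This is the degree-`d` form of the census in `SoloInformedCubicPrimeCount`; the exponents `2 ≤ k ≤ d` are
treated in `SoloInformedQuinticPrimeCount`.
-/

namespace Summit.Parity.BatemanHorn.Theorems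

open Finset Filter ArithmeticFunction Asymptotics Polynomial
open scoped Topology Classical

/-! ### The census -/

/-- **`PP_g(x) ≤ (d log x + B) · (n₀ + ∑_{2 ≤ k ≤ d} #prime `k`-th powers + #higher powers)`** for `g` of
degree `d ≥ 1` with `g(n) > 0` for `n ≥ n₀` and `|log |g(n)| - d log n| ≤ B`. -/
theorem properPrimePow_polyVal_sum_le_natDegree (g : ℤ[X]) {d : ℕ} (hdeg : g.natDegree = d) (hd : 0 < d)
    {n₀ : ℕ} (hpos : ∀ n : ℕ, n₀ ≤ n → 0 < g.eval (n : ℤ)) {B : ℝ}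
    (hB : ∀ n : ℕ, 1 ≤ n → |Real.log ((g.eval (n : ℤ)).natAbs : ℝ) - g.natDegree * Real.log n| ≤ B)
    {x : ℕ} (hx : 1 ≤ x) :
    ∑ n ∈ (Icc 1 x).filter (fun n : ℕ => ¬Nat.Prime (g.eval (n : ℤ)).natAbs), Λ (g.eval (n : ℤ)).natAbs
      ≤ ((d : ℝ) * Real.log x + B) * (n₀
          + ∑ k ∈ Icc 2 d,
              (#((Icc 1 x).filter fun n : ℕ => ∃ p : ℕ, p.Prime ∧ g.eval (n : ℤ) = (p : ℤ) ^ k) : ℝ)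
          + #((range (⌊(Real.exp B * (x : ℝ) ^ d) ^ ((d + 1 : ℕ) : ℝ)⁻¹⌋₊ + 1)).biUnion fun m : ℕ =>
              (range (⌊Real.log (Real.exp B * (x : ℝ) ^ d) / Real.log 2⌋₊ + 1)).biUnion fun k : ℕ =>
                (Icc 1 x).filter fun n : ℕ => (g.eval (n : ℤ)).natAbs = m ^ k)) := by
  set Y : ℝ := Real.exp B * (x : ℝ) ^ d with hY
  set P := ⌊Y ^ ((d + 1 : ℕ) : ℝ)⁻¹⌋₊ with hP
  set K := ⌊Real.log Y / Real.log 2⌋₊ with hK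
  set NP := (Icc 1 x).filter (fun n : ℕ => ¬Nat.Prime (g.eval (n : ℤ)).natAbs) with hNP
  set PK : ℕ → Finset ℕ := fun k =>
    (Icc 1 x).filter fun n : ℕ => ∃ p : ℕ, p.Prime ∧ g.eval (n : ℤ) = (p : ℤ) ^ k with hPK
  set HI := (range (P + 1)).biUnion (fun m : ℕ => (range (K + 1)).biUnion fun k : ℕ =>
    (Icc 1 x).filter fun n : ℕ => (g.eval (n : ℤ)).natAbs = m ^ k) with hHI
  have hx0 : (0 : ℝ) < x := by exact_mod_cast hx
  have hlogx : 0 ≤ Real.log x := Real.log_nonneg (by exact_mod_cast hx)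
  have hd0 : (0 : ℝ) ≤ d := Nat.cast_nonneg _
  have hY0 : 0 < Y := by positivity
  have hlog2 : 0 < Real.log 2 := Real.log_pos (by norm_num)
  -- pointwise bound for the weights
  have hw : ∀ n ∈ NP.filter (fun n : ℕ => Λ (g.eval (n : ℤ)).natAbs ≠ 0),
      Λ (g.eval (n : ℤ)).natAbs ≤ (d : ℝ) * Real.log x + B := by
    intro n hn
    obtain ⟨hn, -⟩ := mem_filter.mp hn
    obtain ⟨hn1, hnx⟩ := mem_Icc.mp (mem_filter.mp hn).1
    have h1 := (abs_le.mp (hB n hn1)).2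
    rw [hdeg] at h1
    have h2 : Real.log n ≤ Real.log x :=
      Real.log_le_log (by exact_mod_cast hn1) (by exact_mod_cast hnx)
    have h3 := mul_le_mul_of_nonneg_left h2 hd0
    linarith [vonMangoldt_le_log (n := (g.eval (n : ℤ)).natAbs)]
  -- where the non-zero weights live
  have hsub : NP.filter (fun n : ℕ => Λ (g.eval (n : ℤ)).natAbs ≠ 0)
      ⊆ range n₀ ∪ (Icc 2 d).biUnion PK ∪ HI := by
    intro n hn
    obtain ⟨hnNP, hΛ⟩ := mem_filter.mp hn
    obtain ⟨hnI, hnp⟩ := mem_filter.mp hnNP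
    obtain ⟨hn1, hnx⟩ := mem_Icc.mp hnI
    obtain ⟨p, k, hp, hk, hpk⟩ := (isPrimePow_nat_iff _).mp (vonMangoldt_ne_zero_iff.mp hΛ)
    rw [mem_union, mem_union]
    by_cases hn0 : n < n₀
    · exact Or.inl (Or.inl (mem_range.mpr hn0))
    have hgpos : 0 < g.eval (n : ℤ) := hpos n (not_lt.mp hn0)
    have hk1 : k ≠ 1 := by
      rintro rfl
      rw [pow_one] at hpk
      exact hnp (hpk ▸ hp)
    by_cases hkd : k ≤ d
    · -- a prime `k`-th power, `2 ≤ k ≤ d`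
      refine Or.inl (Or.inr (mem_biUnion.mpr ⟨k, mem_Icc.mpr ⟨by omega, hkd⟩,
        mem_filter.mpr ⟨hnI, p, hp, ?_⟩⟩))
      rw [← Int.natAbs_of_nonneg hgpos.le, ← hpk]
      all_goals simp
    · -- a higher power: `p ≤ P`, `k ≤ K`
      have hk4 : d + 1 ≤ k := by omega
      have hgY : (((g.eval (n : ℤ)).natAbs : ℕ) : ℝ) ≤ Y := by
        have h1 := (abs_le.mp (hB n hn1)).2
        rw [hdeg] at h1
        have h2 : Real.log n ≤ Real.log x :=
          Real.log_le_log (by exact_mod_cast hn1) (by exact_mod_cast hnx)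
        have h3 := mul_le_mul_of_nonneg_left h2 hd0
        have hg0 : (0 : ℝ) < ((g.eval (n : ℤ)).natAbs : ℕ) := by
          rw [← hpk]
          exact_mod_cast pow_pos hp.pos k
        rw [← Real.exp_log hg0, hY, show Real.exp B * (x : ℝ) ^ d = Real.exp (Real.log ((x : ℝ) ^ d) + B) by
          rw [Real.exp_add, Real.exp_log (by positivity), mul_comm]]
        refine Real.exp_le_exp.mpr ?_
        rw [Real.log_pow]
        linarith
      have hpkR : ((p : ℝ) ^ k) = (((g.eval (n : ℤ)).natAbs : ℕ) : ℝ) := by exact_mod_cast hpk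
      have hpP : p ∈ range (P + 1) := by
        rw [mem_range, Nat.lt_add_one_iff, hP]
        refine Nat.le_floor ?_
        have h4 : (p : ℝ) ^ (d + 1) ≤ Y := by
          calc (p : ℝ) ^ (d + 1) ≤ (p : ℝ) ^ k := pow_le_pow_right₀ (by exact_mod_cast hp.one_lt.le) hk4
            _ ≤ Y := hpkR ▸ hgY
        have hroot : ((p : ℝ) ^ (d + 1)) ^ ((d + 1 : ℕ) : ℝ)⁻¹ = p :=
          Real.pow_rpow_inv_natCast (Nat.cast_nonneg p) (by omega)
        calc (p : ℝ) = ((p : ℝ) ^ (d + 1)) ^ ((d + 1 : ℕ) : ℝ)⁻¹ := hroot.symm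
          _ ≤ Y ^ ((d + 1 : ℕ) : ℝ)⁻¹ := Real.rpow_le_rpow (by positivity) h4 (by positivity)
      have hkK : k ∈ range (K + 1) := by
        rw [mem_range, Nat.lt_add_one_iff, hK]
        refine Nat.le_floor ?_
        rw [le_div_iff₀ hlog2]
        have h2k : (2 : ℝ) ^ k ≤ Y := by
          calc (2 : ℝ) ^ k ≤ (p : ℝ) ^ k := pow_le_pow_left₀ (by norm_num) (by exact_mod_cast hp.two_le) k
            _ ≤ Y := hpkR ▸ hgY
        have := Real.log_le_log (by positivity) h2k
        rwa [Real.log_pow] at this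
      exact Or.inr (mem_biUnion.mpr ⟨p, hpP, mem_biUnion.mpr ⟨k, hkK, mem_filter.mpr ⟨hnI, hpk.symm⟩⟩⟩)
  -- sum ≤ (max weight) · (number of non-zero weights)
  have hcard : (#(NP.filter fun n : ℕ => Λ (g.eval (n : ℤ)).natAbs ≠ 0) : ℝ)
      ≤ n₀ + ∑ k ∈ Icc 2 d, (#(PK k) : ℝ) + #HI := by
    have h := (card_le_card hsub).trans ((card_union_le _ _).trans (Nat.add_le_add_right
      ((card_union_le _ _).trans (Nat.add_le_add_left card_biUnion_le _)) _))
    rw [card_range] at h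
    exact_mod_cast h
  calc ∑ n ∈ NP, Λ (g.eval (n : ℤ)).natAbs
      = ∑ n ∈ NP.filter (fun n : ℕ => Λ (g.eval (n : ℤ)).natAbs ≠ 0), Λ (g.eval (n : ℤ)).natAbs :=
        (sum_filter_ne_zero NP).symm
    _ ≤ #(NP.filter fun n : ℕ => Λ (g.eval (n : ℤ)).natAbs ≠ 0) • ((d : ℝ) * Real.log x + B) :=
        sum_le_card_nsmul _ _ _ hw
    _ ≤ ((d : ℝ) * Real.log x + B) * (n₀ + ∑ k ∈ Icc 2 d, (#(PK k) : ℝ) + #HI) := by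
        rw [nsmul_eq_mul, mul_comm]
        have hB0 : 0 ≤ B := (abs_nonneg _).trans (hB 1 le_rfl)
        have hw0 : 0 ≤ (d : ℝ) * Real.log x + B := by positivity
        gcongr

/-! ### The higher-power count is `O(x^{d/(d+1)} (log x)²)`, hence negligible -/

/-- For every `d ≥ 1`, `B ≥ 0` and `δ > 0`: eventually `(d + 1) log x · 2d (P_x + 1)(K_x + 1) ≤ δ x`, where
`P_x = ⌊(e^B x^d)^{1/(d+1)}⌋`, `K_x = ⌊log(e^B x^d)/log 2⌋`. -/
theorem eventually_higherPow_count_mul_log_le_natDegree {d : ℕ} (hd : 0 < d) {B : ℝ} (hB0 : 0 ≤ B) {δ : ℝ}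
    (hδ : 0 < δ) :
    ∀ᶠ x : ℕ in atTop, ((d : ℝ) + 1) * Real.log x *
      (((⌊(Real.exp B * (x : ℝ) ^ d) ^ ((d + 1 : ℕ) : ℝ)⁻¹⌋₊ + 1)
        * (⌊Real.log (Real.exp B * (x : ℝ) ^ d) / Real.log 2⌋₊ + 1) * (2 * d) : ℕ) : ℝ) ≤ δ * x := by
  have hd0 : (0 : ℝ) < d := by exact_mod_cast hd
  have hd1 : (0 : ℝ) < ((d + 1 : ℕ) : ℝ) := by positivity
  set s : ℝ := ((d + 1 : ℕ) : ℝ)⁻¹ with hs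
  have hs0 : 0 < s := inv_pos.mpr hd1
  have hds : (d : ℝ) * s + s = 1 := by
    rw [hs]
    field_simp
    push_cast
    ring
  set c₀ : ℝ := Real.exp (B * s) with hc₀
  have hc₀0 : 0 < c₀ := Real.exp_pos _
  have hc₀1 : 1 ≤ c₀ := by rw [hc₀]; exact Real.one_le_exp (by positivity)
  have hlog2 : 0 < Real.log 2 := Real.log_pos (by norm_num)
  have hlog2' : Real.log 2 < 1 := by
    have := Real.log_two_lt_d9; norm_num at this; linarith
  have hlog2ne : Real.log 2 ≠ 0 := hlog2.ne'
  set A : ℝ := 4 * d * ((d : ℝ) + 1) * ((d : ℝ) + 2) * c₀ / Real.log 2 with hA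
  have hA0 : 0 < A := by positivity
  have hAne : A ≠ 0 := hA0.ne'
  set η : ℝ := δ / A with hη
  have hη0 : 0 < η := div_pos hδ hA0
  have hlo := ((isLittleO_log_rpow_rpow_atTop 2 hs0).comp_tendsto tendsto_natCast_atTop_atTop).def hη0
  have hlog : Tendsto (fun x : ℕ => Real.log x) atTop atTop :=
    Real.tendsto_log_atTop.comp tendsto_natCast_atTop_atTop
  filter_upwards [hlo, hlog.eventually (eventually_ge_atTop (max B 1)), eventually_ge_atTop 1]
    with x hx hL hx1
  simp only [Function.comp_apply, Real.norm_eq_abs, Real.rpow_two] at hx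
  rw [abs_of_nonneg (sq_nonneg _), abs_of_nonneg (by positivity)] at hx
  set L := Real.log x with hL'
  have hBL : B ≤ L := le_trans (le_max_left _ _) hL
  have hL1 : 1 ≤ L := le_trans (le_max_right _ _) hL
  have hL0 : 0 ≤ L := by linarith
  have hx0 : (0 : ℝ) < x := by exact_mod_cast hx1
  -- `Y^{1/(d+1)} = c₀ x^{d/(d+1)}`, `log Y = B + d L`
  have hYs : (Real.exp B * (x : ℝ) ^ d) ^ s = c₀ * (x : ℝ) ^ ((d : ℝ) * s) := by
    rw [Real.mul_rpow (Real.exp_pos _).le (by positivity), hc₀, ← Real.exp_mul,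
      show ((x : ℝ) ^ d) = (x : ℝ) ^ (d : ℝ) by exact_mod_cast (Real.rpow_natCast (x : ℝ) d).symm,
      ← Real.rpow_mul hx0.le]
  have hlogY : Real.log (Real.exp B * (x : ℝ) ^ d) = B + d * L := by
    rw [Real.log_mul (Real.exp_pos _).ne' (by positivity), Real.log_exp, Real.log_pow]
  have hxds : 1 ≤ c₀ * (x : ℝ) ^ ((d : ℝ) * s) := by
    have h2 : (1 : ℝ) ≤ (x : ℝ) ^ ((d : ℝ) * s) := Real.one_le_rpow (by exact_mod_cast hx1) (by positivity)
    nlinarith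
  -- the two factors
  have hP : ((⌊(Real.exp B * (x : ℝ) ^ d) ^ s⌋₊ : ℕ) : ℝ) + 1 ≤ 2 * (c₀ * (x : ℝ) ^ ((d : ℝ) * s)) := by
    have hfl := Nat.floor_le (show 0 ≤ (Real.exp B * (x : ℝ) ^ d) ^ s by positivity)
    linarith [hYs]
  have hK : ((⌊Real.log (Real.exp B * (x : ℝ) ^ d) / Real.log 2⌋₊ : ℕ) : ℝ) + 1
      ≤ ((d : ℝ) + 2) * L / Real.log 2 := by
    have hfl := Nat.floor_le (show 0 ≤ Real.log (Real.exp B * (x : ℝ) ^ d) / Real.log 2 by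
      rw [hlogY]; positivity)
    have e : Real.log (Real.exp B * (x : ℝ) ^ d) / Real.log 2 + 1 ≤ ((d : ℝ) + 2) * L / Real.log 2 := by
      rw [hlogY, div_add_one hlog2ne, div_le_div_iff_of_pos_right hlog2]
      linarith
    linarith
  -- assemble
  have hx' : (x : ℝ) ^ ((d : ℝ) * s) * (x : ℝ) ^ s = x := by
    rw [← Real.rpow_add hx0, hds, Real.rpow_one]
  calc ((d : ℝ) + 1) * L * (((⌊(Real.exp B * (x : ℝ) ^ d) ^ s⌋₊ + 1)
        * (⌊Real.log (Real.exp B * (x : ℝ) ^ d) / Real.log 2⌋₊ + 1) * (2 * d) : ℕ) : ℝ)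
      = ((d : ℝ) + 1) * L * ((((⌊(Real.exp B * (x : ℝ) ^ d) ^ s⌋₊ : ℕ) : ℝ) + 1)
        * (((⌊Real.log (Real.exp B * (x : ℝ) ^ d) / Real.log 2⌋₊ : ℕ) : ℝ) + 1) * (2 * d)) := by
        push_cast
        ring
    _ ≤ ((d : ℝ) + 1) * L * ((2 * (c₀ * (x : ℝ) ^ ((d : ℝ) * s))) * (((d : ℝ) + 2) * L / Real.log 2)
        * (2 * d)) := by gcongr
    _ = A * (x : ℝ) ^ ((d : ℝ) * s) * L ^ 2 := by
        rw [hA]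
        field_simp
        ring
    _ ≤ A * (x : ℝ) ^ ((d : ℝ) * s) * (η * (x : ℝ) ^ s) := by gcongr
    _ = δ * ((x : ℝ) ^ ((d : ℝ) * s) * (x : ℝ) ^ s) := by
        rw [hη]
        field_simp
    _ = δ * x := by rw [hx']

end Summit.Parity.BatemanHorn.Theorems
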